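import Literature.NumberTheory.EllipticCurves.Rank1Residual.PrintShapeTorsion
import Literature.NumberTheory.EllipticCurves.Rank1Residual.Predicates
import HarnessLib

/-!
# Construction-shaped residual classes: the common TYPE of a missing input (cell `b2b-bsdres`)

HONEST FRAMING (run/shared/lean/b2b/bsd-rank1-residual/): the cell deletes the COMBINATION-SHAPED
residual classes of the BSD formula in analytic rank `≤ 1` from PUBLISHED theorems only; the
CONSTRUCTION-SHAPED classes X2, X3, X4, X5, X7, X8 (r = 1), X12 (RESIDUAL-CASES §a.2 v3, CLASSES.md)
are TYPED — the missing local / Euler-system input is named and its required OUTPUT at a pair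
`(E, p)` is stated as a Lean predicate — and NOT attempted. This is not "finishing BSD".

Definitions + bookkeeping theorems only (explicit binders: predicates, not named facts; nothing is
asserted). For each construction class `Xn` the file `Rank1Residual/Typed/Xn.lean` defines
`Xn.MissingInputAt W p : Prop` — what a future theorem must deliver AT the pair `(E, p)` of the
class — with a docstring recording (i) what kind of object is missing (a main conjecture with
control, a signed/♯♭ theory, a `p`-adic Gross–Zagier formula, …), (ii) the closest published result
VERBATIM with locator, (iii) why it does not reach the class; and proves the conditional class
theorem `Xn.bsdp_of_missingInputAt : r_an ≤ 1 → ClassXn W p → Xn.MissingInputAt W p → BSDp W p`.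
The universally quantified statements "`∀ (E,p) ∈ Xn`, missing input" are OPEN PROBLEMS (no source
proves them); by the tree's rules they are not Literature facts and are recorded only in the cell's
CLASSES.md / HOME, to be filed as `@[conjecture]` obligations under `Summits/…/Theorems` by a
planner if a route ever takes one as a crux.

This file: the common output type. Where the tree has no vocabulary for the missing OBJECT (no
Selmer structure / `p`-adic `L`-function at an additive prime, no signed `±`/♯♭ Selmer groups, no
anticyclotomic tower at `p ‖ N`), the missing input is typed at the level of its OUTPUT in Miller's
currency: `MissingPPartAt W p` := "`#Ш(E/ℚ)_an` is a rational `q` with `ord_p q = ord_p #Ш(E/ℚ)`"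
(for `r_an ≤ 1` this is exactly the last clause of `BSD(E,p)`, Miller 2011 §1: "all but the last
part of `BSD(E/ℚ,p)` is known"), and its two halves `MissingLowerBoundAt` (`ord_p #Ш_an ≤ ord_p #Ш`:
the "Eisenstein-congruence / main-conjecture" direction) and `MissingUpperBoundAt`
(`ord_p #Ш ≤ ord_p #Ш_an`: the "Euler-system / Kato–Kolyvagin" direction), because for several
classes ONE half is in print (e.g. Wuthrich 2014 Prop. 21 gives the upper bound at every odd
non-additive `p` with surjective-or-Borel image in analytic rank `0`).

References: Miller, LMS J. Comput. Math. 14 (2011) §1, Def. 1.1 [Miller2011LMS]; RESIDUAL-CASES.md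
v3 §a.2; Wuthrich, Doc. Math. 19 (2014) Prop. 21 [Wuthrich2014].
-/

noncomputable section

open scoped Classical

open WeierstrassCurve Literature.NumberTheory.EllipticCurves
  Literature.NumberTheory.EllipticCurves.Rank1Residual

namespace Literature.NumberTheory.EllipticCurves.Rank1Residual.Typed

/-- The OUTPUT a missing `p`-part input must deliver at `(E, p)`, in Miller's currency: the analytic
order of `Ш`, `#Ш(E/ℚ)_an = shaAn W` (`W` globally minimal), is a rational number `q` with
`ord_p q = ord_p #Ш(E/ℚ)` — the last clause of `BSD(E,p)` (Miller 2011, Def. 1.1 (iii)–(iv), with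
`ord_p #Ш(p) = ord_p #Ш` for finite `Ш`). A predicate on `(W, p)`; nothing asserted.
[cite: Miller2011LMS, Def. 1.1 (arXiv:1010.2431 p. 3)] -/
def MissingPPartAt (W : WeierstrassCurve ℚ) (p : ℕ) : Prop :=
  ∃ q : ℚ, shaAn W = (q : ℂ) ∧ padicValRat p q = padicValNat p W.shaOrder

/-- The "IMC / Eisenstein-congruence" half of the missing output at `(E, p)`: `ord_p #Ш(E/ℚ)_an ≤ ord_p #Ш(E/ℚ)`
(with `#Ш_an` rational). [cite: Miller2011LMS, Def. 1.1 (arXiv:1010.2431 p. 3)] -/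
def MissingLowerBoundAt (W : WeierstrassCurve ℚ) (p : ℕ) : Prop :=
  ∃ q : ℚ, shaAn W = (q : ℂ) ∧ padicValRat p q ≤ padicValNat p W.shaOrder

/-- The "Euler-system" half of the missing output at `(E, p)`: `ord_p #Ш(E/ℚ) ≤ ord_p #Ш(E/ℚ)_an`
(with `#Ш_an` rational). [cite: Miller2011LMS, Def. 1.1 (arXiv:1010.2431 p. 3)] -/
def MissingUpperBoundAt (W : WeierstrassCurve ℚ) (p : ℕ) : Prop :=
  ∃ q : ℚ, shaAn W = (q : ℂ) ∧ (padicValNat p W.shaOrder : ℤ) ≤ padicValRat p q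

variable (W : WeierstrassCurve ℚ) [W.IsElliptic] (p : ℕ) [Fact p.Prime]

omit [W.IsElliptic] [Fact p.Prime] in
/-- The two halves make the whole (the rational `q` with `shaAn W = q` is unique). Bookkeeping.
[cite: Miller2011LMS, Def. 1.1] -/
theorem missingPPartAt_of_lower_of_upper (hl : MissingLowerBoundAt W p)
    (hu : MissingUpperBoundAt W p) : MissingPPartAt W p := by
  obtain ⟨q, hq, hle⟩ := hl
  obtain ⟨q', hq', hge⟩ := hu
  have hqq : q' = q := by exact_mod_cast hq'.symm.trans hq
  subst hqq
  exact ⟨q', hq, le_antisymm hle hge⟩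

omit [W.IsElliptic] [Fact p.Prime] in
/-- Conversely the whole gives both halves. Bookkeeping. [cite: Miller2011LMS, Def. 1.1] -/
theorem lower_and_upper_of_missingPPartAt (h : MissingPPartAt W p) :
    MissingLowerBoundAt W p ∧ MissingUpperBoundAt W p := by
  obtain ⟨q, hq, hv⟩ := h
  exact ⟨⟨q, hq, hv.le⟩, ⟨q, hq, hv.ge⟩⟩

/-- **Missing output ⇒ `BSD(E,p)` in analytic rank `≤ 1`.** Granted Gross–Zagier–Kolyvagin
(`hGZK` = bsd.S17: `rank = r_an`, `Ш` finite), the missing output at `(E,p)` is exactly what is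
left of Miller's `BSD(E,p)`: `ord_p #Ш(p) = ord_p #Ш` for finite `Ш`
(`padicValNat_card_addPrimaryComponent`). [cite: Miller2011LMS, §1 and Def. 1.1] [cite: Darmon2004, Thm. 3.22] -/
theorem bsdp_of_missingPPartAt (hGZK : rank_eq_analyticRank_of_analyticRank_le_one)
    (hr : W.analyticRank ≤ 1) (h : MissingPPartAt W p) : BSDp W p := by
  obtain ⟨hrank, hfin⟩ := hGZK W hr
  haveI : Finite W.sha := hfin
  obtain ⟨q, hq, hv⟩ := h
  refine ⟨hrank, Finite.of_injective _ Subtype.val_injective, q, hq, ?_⟩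
  rw [hv, WeierstrassCurve.shaOrder, padicValNat_card_addPrimaryComponent]

omit [W.IsElliptic] in
/-- Conversely `BSD(E,p)` gives the missing output (so `MissingPPartAt` is not weaker than needed):
for finite `Ш`, `ord_p #Ш(p) = ord_p #Ш`. [cite: Miller2011LMS, Def. 1.1] -/
theorem missingPPartAt_of_bsdp [Finite W.sha] (h : BSDp W p) : MissingPPartAt W p := by
  obtain ⟨-, -, q, hq, hv⟩ := h
  refine ⟨q, hq, ?_⟩
  rw [hv, WeierstrassCurve.shaOrder, padicValNat_card_addPrimaryComponent]

/-- The cell's general print shape `PPart W p` (`L^{(r)}(E,1)/(r!·Ω·Reg)` rational with the BSD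
valuation, torsion term included) delivers the missing output, in analytic rank `≤ 1` (modularity
`hmod` for `L^{(r)}(E,1) ≠ 0`, GZK `hGZK` for finiteness): via `bsdp_of_pPart`. [cite: Miller2011LMS, Def. 1.1] -/
theorem missingPPartAt_of_pPart (hmod : hasEntireLFunction_rat)
    (hGZK : rank_eq_analyticRank_of_analyticRank_le_one) (hr : W.analyticRank ≤ 1)
    (h : PPart W p) : MissingPPartAt W p := by
  haveI : Finite W.sha := (hGZK W hr).2
  exact missingPPartAt_of_bsdp W p (bsdp_of_pPart W p hmod hGZK hr h)

end Literature.NumberTheory.EllipticCurves.Rank1Residual.Typed
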